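import Summits.ResolutionOfSingularities.ResolutionOfSingularities.Theorems.SatelliteTransport2
import Literature.AlgebraicGeometry.Resolution.BlowupSNC
import HarnessLib

/-!
# HistoryTransport — decomp-res node «HistoryCut» (lens-4 g29, critic row 169), tree file 1/4 of the node

Content VERBATIM from the decomp-res lens-4 g29 node `HOME/decomp-res-lens-4/g29/HistoryCut.lean` (pin aaa5a818 =
`parts/HistoryCut-g29-aaa5a818.lean`,
1563 l; HOME = run/shared/lean/pub/decomp-res): its ONE NEW PART §78–§80 = `parts/part_new-g29-0eb23edf.lean` (45
declarations); the node's carried copy of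
g28 §75–§77 is NOT used — those sections are the LANDED `Theorems/SatelliteTransport` · `SatelliteTransport2` ·
`SatelliteCutCells` · `MaxContactCutSatelliteCut`
(critic row 169 (1): land g28 first, from pin b83bf2f8, then this part over it).  Farm (node): rc 0 · 0 err · 0 warn
· 0 sorry · axioms {propext, Classical.choice, Quot.sound}.
Critic: CRITIC-LEDGER row 169 (2026-08-31T02:31:59Z): CLEARED +1 (THE HISTORY LAW `wInv_of_history_window`: no
kangaroo jump on ANY exceptional component born
inside a principal jump-free window — Hauser's kangaroo condition (3) beyond the satellite case, weight = char = p,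
every field; typed sub-cell
`n.Prime ∧ OldComponentJumpTower n` of the g28 residual EMPTY for every `n`; EXACT hypothesis-free re-location to
`NoWildFreshJumpShallowCompanionKangarooTowers`).
Landing orders INBOX :708 (lens-4 g29 landing note, NEXT-g30 §3) endorsed by the critic :721: `--kind proof
--supports stmt-ResolutionOfSingularities-28338`,
namespace `…Theorems.HugValuationCut`, canonical headers, D-0064 split: `HistoryTransport` (§78; +
`HistoryTransport2` where the 400-line cap cuts) ·
`HistoryCutCells` (§79–§80 minus the four `h71` corollaries; cone-free cells: the aside home) ·
`MaxContactCutHistoryCut` (the four corollaries GIVEN 31571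
`MaxContactCut.NoContactHuggingTowers` BY NAME — Theses cone, kept apart so that the route file can import the aside
home without an import cycle).
Aside bookkeeping (row 169 (3) / :721): ONE successor aside on the lens-4 column,
`NoWildFreshJumpShallowCompanionKangarooTowers` (home `HistoryCutCells`), filed
DIRECTLY as successor of the live g27 aside `NoWildShallowCompanionKangarooTowers` (the g28 switch to
`NoWildFreeJumpShallowCompanionKangarooTowers` was never
filed — one switch, exactly one live aside); the decided cells `NoWildSatelliteJumpShallowTowers` (g28) and
`NoWildOldComponentJumpShallowTowers` (g29) are THEOREMS and are not filed.

The lens header, verbatim: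

> # HistoryCut — decomp-res-lens-4 g29 «HistoryCut» (lens: minimal counterexample / extremal reduction)
>
> NODE g29 of the lens-4 chain (HugValuationCut g21 → … → CompanionCut g26 → AntelopeCut g27 → SatelliteCut g28 →
HistoryCut g29).
> TARGET = g28's located residual `NoWildFreeJumpShallowCompanionKangarooTowers` (wild · off-locus singular class ·
`p`-power form
> at every marked point · weight-`n` kangaroo-recurrent · companion-recurrent · shallow · at prime weight NOT
satellite-jumping).  The
> critic's g29 window (CRITIC-LEDGER row 164): the location / exceptional-letter axis is priced ONCE — `+1` only for Hauser's
> kangaroo condition (3) IN FULL in kernel (the boundary memory over the exceptional letters, transported through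
FREE and SATELLITE
> moves, killing a typed sub-cell of the target with an EXACT hypothesis-free re-location and entrances on both sides) or for a
> FINITENESS law; no further one-component variants.
>
> THE LAW OF THIS NODE — «NO KANGAROO JUMP ON ANY EXCEPTIONAL COMPONENT BORN INSIDE A PRINCIPAL JUMP-FREE WINDOW»
(§78–§79, KERNEL,
> PROVED, weight = characteristic = `p`, EVERY field, no perfectness; `wInv_of_history_window`): along a `p`-power
forced tower of
> weight `p`, let the stages `b, b+1, …, b+l` carry PRINCIPAL weak contact along the transforms of one regular
hypersurface germ `H`
> of stage `b` (`𝓘 ⊆ (f) + 𝔪^{2p}`, `f ≡ c·z^p mod 𝔪^{p+1}`), let stage `b+l+1` be JUMP-FREE along `H^{(l+1)}`, and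
let the marked
> point `x_{b+l+2}` lie on the strict transform `E_{b+1}^{(l+1)}` of the exceptional component `E_{b+1} =
π_b^{-1}(x_b)` BORN at the
> first blow-up of the window.  THEN stage `b+l+2` is jump-free along `H^{(l+2)}`.  Re-basing the window at the
birth stage of each
> component, EVERY component `E_{b+1}, …, E_{b+l+1}` born inside the window is covered; contrapositively
(`jump_point_is_fresh`) A
> KANGAROO JUMP ENDING A PRINCIPAL JUMP-FREE WINDOW HAPPENS AT A POINT LYING ON NONE OF THE COMPONENTS BORN INSIDE
THE WINDOW — it
> meets, among them, the newest exceptional divisor only.  `l = 0` is g28's satellite law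
(`oldComponentJumpTower_of_satelliteJumpTower`,
> `satelliteJumpTower_of_oldComponent_zero`).  This is the forced-tower form of Hauser's kangaroo condition (3)
[arXiv:0811.4151 §C,
> Kangaroo Theorem (3): «a' lies on none of the strict transforms of the exceptional components …»; Hauser, Bull. AMS 47 (2010)
> pp. 17–18] for the TREE's jump notion (loss of weak contact along the transported hypersurface, g24
`EventuallyJumpFree`), with NO
> residue condition: inside a principal jump-free window the memory of every exceptional letter is a DIVISIBILITY of
the tail, and
> divisibility by two independent parameters is incompatible with a non-zero `p`-power form of degree `p`.
>
> MECHANISM (three transports + one algebraic lemma; the window of arbitrary length is load-bearing).  The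
transported presentation
> carries a MEMORY `ETail 𝓘 H E p x` («some `w ∈ 𝓘_x` has `w − c·z^p ∈ (t) ∩ 𝔪^{p+1}`, `(t) = E_x`, `(t, z)` joint regular
> parameters»).  (S1, g28 `eTail_point_transport`) memory of the NEW component is CREATED by one jump-free point blow-up after a
> principal stage; (S3, NEW `eTail_strict_transport`) memory of an OLD component `E` SURVIVES a further jump-free
point blow-up at a
> point of the strict transform `E'` after a principal stage: in ONE joint chart round (`point_round_chart_rsop₂`:
`π^*t = s·t₁`,
> `π^*z = s·z'`, `E' = (t₁)`, `H' = (z')`, `(s, t₁, z')` part of one regular system) the tail becomes `s·t₁·g₁`, and the no-jump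
> witness `f₁ = e·w₀ + k₂·s^p` (transported principality `𝓘' ⊆ (w₀) + (s^p)`) has `e` a unit (LEMMA Z, g28) and `k₂
∈ 𝔪` by the NEW
> three-letter LEMMA Z₃ `mem_maximalIdeal_of_rsopTriple` («`δ·s^p ∈ (t₁, z') + 𝔪^{p+1}` with `(s, t₁, z')`
regular-system letters
> forces `δ ∈ 𝔪`», via primality of `(t₁, z')`-quotients of a regular local ring), whence `s·t₁·g₁ ∈ (t₁) ∩ 𝔪^{p+1}`;
> (`eTail_excIter_of_window`) structural recursion on the window transports the memory of `E_{b+1}` to stage `b+l+1` along the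
> iterated strict transforms `excIter T b l`; (S2, g28 `wInv_of_eTail_satellite` + LEMMA D) at a point of `E_{b+1}^{(l+1)}` the
> memory forbids the jump.  PRINCIPALITY along the window is what makes the re-witnessing possible (`exists_principal_eTail`).
>
> THE CUT (§80): typed sub-cell `OldComponentJumpTower n T` (∃ `b l H`: `PWInv` at `b, …, b+l` along the transforms
of `H`, `WInv`
> at `b+l+1`, `x_{b+l+2} ∈ supp (excIter T b (l+1))`, `¬WInv` at `b+l+2`); DECIDED cell = g27 residual ∧ (`n` prime ∧
> `OldComponentJumpTower n`) =: `WildOldComponentJumpShallowCompanionKangarooTowersTerminate n` — EMPTY for every `n` over every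
> field (`wildOldComponentJumpShallow_holds`: `p ∣ n`, `n` prime ⇒ `p = n`, then `no_oldComponentJumpTower`); it CONTAINS g28's
> decided cell (`noWildSatelliteJumpShallowTowers_of_oldComponent`).  LOCATED RESIDUAL = g27 residual ∧ ¬(`n` prime ∧
> `OldComponentJumpTower n`) =: `WildFreshJumpShallowCompanionKangarooTowersTerminate n`, by name
> `NoWildFreshJumpShallowCompanionKangarooTowers` ⊆ g28's residual (`wildFreshJumpShallow_of_g28`).  EXACT hypothesis-free
> re-locations: `wildFreeJumpShallow_iff_g29` / `noWildFreeJumpShallowCompanionKangarooTowers_iff_g29` (THE TARGET ⟺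
THE RESIDUAL),
> `noWildFreeJumpShallowCompanionKangarooTowers_iff_old_and_fresh` (TARGET ⟺ DECIDED ∧ RESIDUAL),
`wildShallowCompanionKangaroo_iff_g29`,
> `noWildShallowCompanionKangarooTowers_iff_g29`, `noWildCompanionKangarooTowers_iff_g29`, and GIVEN 31571 (`h71`)
the whole aside
> chain down to the tree aside 28338 (`noWildContactFreeOffLocusTowers_iff_g29`).
>
> INHABITANTS (by hand — exponent bookkeeping of the monomial transforms + point counts of the order-`≥ p` locus
over `F_q`, scripts
> `g29/scratch/inhab/`; ring dimension 3).  DECIDED side: (a) `l = 0` — g28's chain `z² + u³ + v⁵ → z'² + u'³v + v³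
→ z''² + u'²v'' +
> u'v''³` (char 2) enters by inclusion; (b) `l = 1`, BEYOND g28 — char 5, weight 5: `z⁵ + x⁹ + y¹²` → (`y`-chart
origin, on `E_{b+1} =
> (y)`) `z⁵ + y⁷ + x⁹y⁴` → (`x`-chart origin = the satellite point `E_{b+2} ∩ E_{b+1}'`) `z⁵ + x²y⁷ + x⁸y⁴` →
(`x`-chart origin = the
> point `E_{b+3} ∩ E_{b+1}''`, OFF `E_{b+2}'`) `z⁵ + x⁴y⁷ + x⁷y⁴`: order 5, tangent form `z_i⁵` and support `=
{x_i}` (over `F_25`)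
> at all four points, both window stages principal — the configuration of the law with `l = 1` occurs, g28's law is silent at
> `x_{b+3}` (it lies off `E_{b+2}'`), and the predicted absence of a jump is visible (`in₅ = z⁵`).  RESIDUAL side:
(a) g28's free
> jump `Z² + U³ + U²T + T⁵` (char 2, `l = 0`); (b) a FRESH jump ending an `l = 1` window — char 5: `z⁵ + x⁴(y³ − x²)² + x⁷y²` →
> (`y`-chart origin) `z⁵ + x⁴y⁵ + 3x⁶y⁴ + x⁷y⁴ + x⁸y³` → (`x`-chart origin, satellite) `z⁵ + x⁴y⁵ + 3x⁵y⁴ + x⁶y³ +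
x⁶y⁴` → (`x`-chart,
> THE POINT `y = 1` of `E_{b+3}`: off `E_{b+1}'' = (y)` and off `E_{b+2}'`) `z⁵ + x⁴y³(y − 1)² + x⁵y⁴`, whose
tangent form at that
> point is `(z + x)⁵`: weak contact along `z` is LOST (the letter `x⁵` of the NEW exceptional divisor) and regained along the
> calibrated line `z + x` — a jump at a FRESH point exactly as the law allows; supports isolated at all four points
(`F_25` counts
> 1, 1, 1, 2 — the second point of the last chart is the satellite point `E_{b+3} ∩ E_{b+1}''`, which carries NO jump).
> EMPTINESS REMARK (same bookkeeping): in ring dimension 3 the helper monomial that isolates `x_{b+1}` on `E_{b+1}`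
(`x^i y^j z^k`,
> `i+j+2k ≤ 2p−1`) reaches degree `≤ 2p−4−2k < p` after two further `E_{b+1}`-satellite steps, so for `p ≤ 3` NO
weight-`p` tower
> makes two consecutive satellite steps after a principal stage: the `l ≥ 1` configurations of BOTH cells are empty
for surfaces in
> characteristic 2 and 3 (the census characteristic), and start at `p = 5`; this is why the node's new content is certified in
> char 5.  CENSUS (HOME/census/it/kangjump · kangsat, 382 weight-`p` chains): consistent — every recorded jump is by
the letter of the NEWEST
> exceptional coordinate, no post-jump node sits on an older component; desk prediction: no chain contains «weak
contact at `b` → no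
> jump at `b+1` → `x_{b+2} ∈ E_{b+1}'` → `x_{b+3} ∈ E_{b+1}''` » for `p ≤ 3` (the long satellite runs of T-satellite
follow a JUMP move).
> DELIMITERS: (i) PRIME WEIGHT ONLY (composite `n = 4`, `p = 2`: `s²t₁²` is a `p`-power form; the decided cell is
typed `n.Prime ∧ …`);
> (ii) components born BEFORE the window's first stage `b` are not covered AS TYPED — they are covered whenever the
same germ line
> extends back, principal and jump-free, to their birth stage (re-base the window there); genuinely not covered: components born
> before the LAST JUMP of the line system (a jump resets the line; the calibrated re-rooting lemma that would carry the memory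
> across a jump is NEXT-g30's LEMMA J); (iii) `PWInv` at every principal stage of the window (automatic at
hypersurface points of
> order-`p` `p`-power germs, hence along all census chains); (iv) no FINITENESS statement is made (length of windows unbounded).
>
> CARRY: of g28's §74–§77 (`SatelliteCut.lean`, pin sha256 b83bf2f8…) only §74 had landed at assembly time (tree
> `Theorems/SatelliteAlgebra`, 2026-08-31T01:56Z, IMPORTED); §75–§77 (pin ll. 294–994 ⊂
`g28/parts/part_new-g28-3bc4b3a5.lean`) are
> carried VERBATIM between the banner below and `end SatelliteCells`; on landing of `SatelliteTransport` ·
`SatelliteTransport2` ·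
> `SatelliteCutCells` · `MaxContactCutSatelliteCut` replace the block by those imports (the carried docstring
example «Z²+U²T+T⁶+T⁷» of the pin is the one the critic flagged non-isolated, INBOX :658; the valid `l = 0` residual
entrance is `Z²+U³+U²T+T⁵` — verbatim carry, corrected at landing).  The NEW part is §78–§80 (45
> declarations): 0 sorry · axioms ⊆ {propext, Classical.choice, Quot.sound} · no `instance` · no `notation` · every field.

## This file

§78 (NEW, KERNEL) THE MEMORY SURVIVES SATELLITE MOVES — `section HistoryAlgebra` (universe `uH`; three letters of
ONE regular system of parameters: `isRsopPart_pair_of_triple`, `isPrime_span_singleton_of_triple`,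
`head_not_mem_span_of_triple`, LEMMA Z₃ **`mem_maximalIdeal_of_rsopTriple`** — coefficient extraction of `s^n`
modulo the prime of the completed system) and `section HistoryTransport` (universe `uT'`; `exists_principal_eTail`
(re-witnessing a principal `E`-tailed presentation), the joint chart lemma **`point_round_chart_rsop₂`** for a
regular PAIR (keeps its `set_option maxHeartbeats 400000 in`), and S3 **`eTail_strict_transport`** — the memory
`ETail` of an OLD component `E` is KEPT by a jump-free blow-up at a point of the strict transform of `E` over a
principal stage), continued in `HistoryTransport2` where the 400-line cap cuts.  Imports `SatelliteTransport2`
(S1/S2, `PWInv`, `ETail`, the g28 transport) + Literature `BlowupSNC` (strict transforms of SNC components).  (This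
first part carries: `isRsopPart_pair_of_triple`, `isPrime_span_singleton_of_triple`, `head_not_mem_span_of_triple`,
`mem_maximalIdeal_of_rsopTriple`, `exists_principal_eTail`.)

[WRITER NOTE (decomp-res writer g10): file split only (tree files ≤ 400 lines); namespace, universes, sections,
section variables and every declaration
exactly as in the lens (the node's global dupNamespace-linter line is dropped — the library sets it; the `open
…Theses` line lives only in the wiring file;
`set_option maxHeartbeats … in` prefixes of single declarations are kept).]

(Sources: Hauser2010Kangaroo (arXiv:0811.4151 p. 6, Kangaroo Theorem condition (3) + remark (a)); HauserPerlega2019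
§2; Hauser2024 PRIMS 60; Moh1987; Matsumura1987 Thms. 14.2–14.3; ZariskiSamuel1960 VIII §11; StacksProject Tags
0804, 0BIQ, 00NQ; DeJong1996 2.4; CossartPiltant2008 §2; Giraud1975.)
-/

noncomputable section

open CategoryTheory AlgebraicGeometry IsLocalRing
open Literature.AlgebraicGeometry.Resolution
open Summit.ResolutionOfSingularities.ResolutionOfSingularities.Theorems
open WeakOrderReduction ForcedTowerClasses DivergentTowerClasses MonomialTowerClasses
open HugDimensionClasses HugDimensionKernels SurfaceShadowClasses SurfaceShadowKernels
open NearPointCut (SingularClass)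
open AbsoluteContactClasses (IsAbsContactAt SepResidueAt diffIdeal_restrict_le stalkMap_comp_toStalk_eq_stalkHom)
open scoped BigOperators

namespace Summit.ResolutionOfSingularities.ResolutionOfSingularities.Theorems.HugValuationCut

section HistoryAlgebra

universe uH
variable {R : Type uH} [CommRing R]

/-! ## §78 (g29 · NEW · KERNEL) THE MEMORY SURVIVES SATELLITE MOVES: three letters of one regular system of parameters, the
joint chart lemma for a regular PAIR, the principal `E`-tailed presentation, and the STRICT TRANSPORT of `ETail` through a
jump-free blow-up at a point of the strict transform of the OLD component `E`

S3 (`eTail_strict_transport`) is the new kernel brick of this node: S1 (g28) creates the memory of the NEWEST exceptional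
component one jump-free blow-up after a principal stage; S3 says the memory of an OLDER component `E` is KEPT by every later
jump-free blow-up whose point still lies on the strict transform of `E` (a satellite move with respect to `E`), provided the
stage is principal.  Chart side: the regular pair `(t, z)` (`E = (t)`, `H = (z)`) is completed to ONE regular system `c` of
`𝒪_x`; in the Rees chart `𝒪_y = (𝒪_x[𝔪/c_i])_𝔴` the three elements `(c_i, t/c_i, z/c_i) = (s, t₁, z')` are members of the
chart's regular system (`isRsopPart_chartFamily_reesChart`), so `(s, t₁, z')` IS PART OF ONE REGULAR SYSTEM OF PARAMETERS of
`𝒪_y` when `t₁, z' ∈ 𝔪_y`.  Ring side: the transported tail is `s·t₁·g₁`; the no-jump witness is `f₁ = e·w₀ + k₂·s^n`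
(transported principality); LEMMA Z on the pair `(s, z')` makes `e` a unit and `e·c' ≡ c₁ (mod 𝔪)`; LEMMA Z₃ — coefficient
extraction of `s^n` modulo the PRIME `(t₁, z', …)` of the completed system — makes `k₂ ∈ 𝔪`; hence `s·t₁·g₁ ∈ 𝔪^{n+1}` and
`w₀` itself witnesses `ETail` with respect to the strict transform `E' = (t₁)` (AND with respect to `E_new = (s)`).
(Sources: Matsumura1987, Thms. 14.2–14.3; StacksProject, Tags 0804, 0BIQ; DeJong1996, 2.4; Hauser2010Kangaroo.) -/

/-- a PAIR extracted from a TRIPLE of one regular system of parameters is part of a regular system. (Sources: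
Matsumura1987, Thm. 14.2.) -/
theorem isRsopPart_pair_of_triple [IsLocalRing R] {x : Fin 3 → R} (h : IsRsopPart x) (ι : Fin 2 → Fin 3)
    (hι : Function.Injective ι) : IsRsopPart ![x (ι 0), x (ι 1)] :=
  isRsopPart_of_range_eq (h.comp ι hι) rfl (by
    have e : x ∘ ι = ![x (ι 0), x (ι 1)] := by
      funext r
      fin_cases r <;> rfl
    rw [e])

/-- each member of a regular triple generates a PRIME ideal. (Sources: Matsumura1987, Thm. 14.3.) -/
theorem isPrime_span_singleton_of_triple [IsLocalRing R] {x : Fin 3 → R} (h : IsRsopPart x) (j : Fin 3) :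
    (Ideal.span {x j}).IsPrime := by
  have h1 := (h.comp (fun _ : Fin 1 => j) (Function.injective_of_subsingleton _)).isPrime_span_range
  have e : x ∘ (fun _ : Fin 1 => j) = fun _ => x j := rfl
  rwa [e, Set.range_const] at h1

/-- the head of a regular triple is not a multiple of another member. (Sources: Matsumura1987, Thm. 14.3.) -/
theorem head_not_mem_span_of_triple [IsLocalRing R] {x : Fin 3 → R} (h : IsRsopPart x) {j : Fin 3} (hj : j ≠ 0) :
    x 0 ∉ Ideal.span {x j} := by
  have h1 := h.not_mem_span_image (S := {j}) (i := 0) (by simpa using hj.symm)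
  rwa [Set.image_singleton] at h1

/-- **LEMMA Z₃ (coefficient extraction along the exceptional letter against TWO further letters).** If `(s, a, b)` is part of
one regular system of parameters then `δ·s^n ∈ (a, b) + 𝔪^{n+1}` forces `δ ∈ 𝔪` — the co-parameter prime of `s` in a
completed system contains `a` and `b`. (Sources: Matsumura1987, Thm. 14.3.) -/
theorem mem_maximalIdeal_of_rsopTriple [IsLocalRing R] {s a b : R} (h : IsRsopPart ![s, a, b]) {δ : R} {n : ℕ}
    (hδ : δ * s ^ n ∈ Ideal.span {a, b} ⊔ maximalIdeal R ^ (n + 1)) : δ ∈ maximalIdeal R := by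
  haveI := h.isRegularLocalRing
  obtain ⟨e, x, hd, hfull, hx0⟩ := h.exists_rsop
  have hxr : IsRsopPart x := isRsopPart_of_span_eq hd hfull
  have hxs : x (Fin.castAdd e 0) = s := by rw [hx0]; rfl
  have hxa : x (Fin.castAdd e 1) = a := by rw [hx0]; rfl
  have hxb : x (Fin.castAdd e 2) = b := by rw [hx0]; rfl
  have hne1 : Fin.castAdd e (1 : Fin 3) ≠ Fin.castAdd e 0 := fun h' => absurd (Fin.castAdd_injective 3 e h') (by decide)
  have hne2 : Fin.castAdd e (2 : Fin 3) ≠ Fin.castAdd e 0 := fun h' => absurd (Fin.castAdd_injective 3 e h') (by decide)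
  refine coeff_mem_maximalIdeal hxr hfull (Fin.castAdd e 0) (n := n) ?_
  rw [hxs]
  have hle : Ideal.span {a, b} ⊔ maximalIdeal R ^ (n + 1) ≤
      Ideal.span (x '' {i | i ≠ Fin.castAdd e 0}) ⊔ maximalIdeal R ^ (n + 1) := by
    refine sup_le_sup_right ?_ _
    rw [Ideal.span_le]
    rintro r hr
    rcases hr with rfl | hr
    · rw [SetLike.mem_coe, ← hxa]
      exact Ideal.subset_span ⟨Fin.castAdd e 1, hne1, rfl⟩
    · rw [Set.mem_singleton_iff] at hr
      rw [hr, SetLike.mem_coe, ← hxb]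
      exact Ideal.subset_span ⟨Fin.castAdd e 2, hne2, rfl⟩
  exact hle hδ

end HistoryAlgebra

section HistoryTransport

universe uT'
variable {X X' : Scheme.{uT'}} {π : X' ⟶ X} {C : X.IdealSheafData}

/-- **The PRINCIPAL `E`-TAILED presentation** (`PWInv` ∧ `ETail` ⟹ one witness doing both): if `𝓘_y` is principal modulo
`𝔪^{2n}` along some weak-contact witness and `ETail 𝓘 H E n y` holds, then the `E`-tailed witness `f` is itself a principal
generator: `𝓘_y ⊆ (f) + 𝔪^{2n}`.  (Both witnesses are `≡ unit·z^n (mod 𝔪^{n+1})`; LEMMA Z compares the units.) [folklore] -/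
theorem exists_principal_eTail {Y : Scheme.{uT'}} {I H E : Y.IdealSheafData} {n : ℕ} (hn : 1 ≤ n) {y : Y}
    (hP : PWInv I H n y) (h : ETail I H E n y) :
    ∃ z t : Y.presheaf.stalk y, stalkIdeal H y = Ideal.span {z} ∧ stalkIdeal E y = Ideal.span {t} ∧
      IsRsopPart ![t, z] ∧
      ∃ f ∈ stalkIdeal I y, stalkIdeal I y ≤ Ideal.span {f} ⊔ maximalIdeal (Y.presheaf.stalk y) ^ (2 * n) ∧
        ∃ c : Y.presheaf.stalk y, IsUnit c ∧
          f - c * z ^ n ∈ Ideal.span {t} ∧ f - c * z ^ n ∈ maximalIdeal (Y.presheaf.stalk y) ^ (n + 1) := by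
  obtain ⟨z, t, hHz, hEt, hrs, f, hfI, c, hc, hft, hfm⟩ := h
  obtain ⟨z₀, hHz₀, -, -, f₀, -, hpr, c₀, -, hf₀z₀⟩ := hP
  have h1 : z₀ ∈ Ideal.span {z} := by rw [← hHz, hHz₀]; exact Ideal.mem_span_singleton_self _
  obtain ⟨a, ha⟩ := Ideal.mem_span_singleton'.mp h1
  obtain ⟨b₁, hb₁, r, hr, hfr⟩ := Submodule.mem_sup.mp (hpr hfI)
  obtain ⟨α, rfl⟩ := Ideal.mem_span_singleton'.mp hb₁
  have h2n : maximalIdeal (Y.presheaf.stalk y) ^ (2 * n) ≤ maximalIdeal _ ^ (n + 1) :=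
    Ideal.pow_le_pow_right (by omega)
  have hδ : (c - α * c₀ * a ^ n) * z ^ n ∈ Ideal.span {t} ⊔ maximalIdeal _ ^ (n + 1) := by
    refine Ideal.mem_sup_right ?_
    have e1 : (c - α * c₀ * a ^ n) * z ^ n = α * (f₀ - c₀ * z₀ ^ n) + r - (f - c * z ^ n) := by
      rw [← hfr, ← ha]; ring
    rw [e1]
    exact sub_mem (add_mem (Ideal.mul_mem_left _ _ hf₀z₀) (h2n hr)) hfm
  have hδm := mem_maximalIdeal_of_rsopPair hrs hδ
  have hαu : IsUnit α := by
    have hu : IsUnit (α * c₀ * a ^ n) := by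
      by_contra hnu
      have hm : α * c₀ * a ^ n ∈ maximalIdeal _ :=
        (IsLocalRing.mem_maximalIdeal _).mpr (mem_nonunits_iff.mpr hnu)
      have hcm : c ∈ maximalIdeal _ := by
        have e1 : c = (c - α * c₀ * a ^ n) + α * c₀ * a ^ n := by ring
        rw [e1]; exact add_mem hδm hm
      exact ((IsLocalRing.mem_maximalIdeal _).mp hcm) hc
    exact isUnit_of_mul_isUnit_left (isUnit_of_mul_isUnit_left hu)
  obtain ⟨u, hu⟩ := hαu
  refine ⟨z, t, hHz, hEt, hrs, f, hfI, ?_, c, hc, hft, hfm⟩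
  refine hpr.trans (sup_le ?_ le_sup_right)
  rw [Ideal.span_singleton_le_iff_mem]
  have e1 : f₀ = (↑u⁻¹ : Y.presheaf.stalk y) * (f - r) := by
    rw [← hfr, ← hu, add_sub_cancel_right, ← mul_assoc, Units.inv_mul, one_mul]
  rw [e1]
  exact Ideal.mul_mem_left _ _ (sub_mem (Ideal.mem_sup_left (Ideal.mem_span_singleton_self f)) (Ideal.mem_sup_right hr))

end HistoryTransport

end Summit.ResolutionOfSingularities.ResolutionOfSingularities.Theorems.HugValuationCut
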